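import Summits.BirchSwinnertonDyer.BirchSwinnertonDyer.Theorems.GenusKolyvaginAtTwoGenusPrimitiveSupplyAtTwoTwistSelmerStrictInherit
import Summits.BirchSwinnertonDyer.Uniform.U2.TransportA
import Summits.BirchSwinnertonDyer.Rank1Residual.Partition.CellOf
import Summits.BirchSwinnertonDyer.Rank1Residual.X5.RationalTwoTorsionPoints
import Literature.NumberTheory.EllipticCurves.BSDRankZeroDensityProofs
import Literature.NumberTheory.EllipticCurves.QuadraticTwistHeegnerRootNumberProofs
import Literature.NumberTheory.EllipticCurves.RootNumberSmulProofs
import HarnessLib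

/-!
# Route `GenusKolyvaginAtTwo`, crux #2 `GenusPrimitiveSupplyAtTwo` (stmt-BirchSwinnertonDyer-22136):
# Mazur–Rubin Cor. 3.4 (i) UP for the prime Heegner twin — `#Sel₂(E^{(d_K)}) = 2 · #Sel₂(E)` when `Sel₂(E)` is STRICT at the
# ramified prime — as a KERNEL theorem modulo Poitou–Tate, Tate's χ, the 2-parity theorem, the Cassels–Tate pairing and modularity

Width seat `bsd-line-gk2-p4` g9 (cell `bsd-f1-sign2`), fourteenth file of the twisting-prime series (crux workfile
`Lines/genus-supply-depth-class.md` §4). THEOREMS ONLY (no definition, no named fact, no `sorry`); helper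
`--supports stmt-BirchSwinnertonDyer-22136`; no item is closed; BSD is not proved by any of this.

WHY. With gk2-p5's DOWN instance (`natCard_selmerGroup_eq_two_mul_of_not_le_strictLocalKer`, p624297: NOT strict ⟹ `#Sel₂(W) =
2·#Sel₂(Wd)`, modulo {PT, Tate χ}) and this seat's strict INHERITANCE (`natCard_selmerGroup_dvd_twin_of_le_strictLocalKer`, p625846:
strict ⟹ `#Sel₂(W) ∣ #Sel₂(Wd)`, unconditional), the one missing piece of Mazur–Rubin's Cor. 3.4 (i) for the prime Heegner twin is the
EXACT strict statement «`#Sel₂(Wd) = 2·#Sel₂(W)`» (UP). The lead's p622198 header and gk2-p5's 10:17Z note record it as not done: it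
needs a PARITY input beyond Poitou–Tate (the localisation image of the relaxed group at `ℓ` is its own orthogonal complement for the
alternating local Tate pairing, so duality cannot separate the two ramified lines). Over `ℚ` for the prime Heegner twin the parity
input is available BY NAME from route items: the 2-parity theorem (`TwoParityDD` = `∀ V, p_parity V 2`, Dokchitser–Dokchitser), the
Cassels–Tate pairing (`CasselsTatePairingRat`), and modularity (`ModularityExistsNewform`, for the root number of the Heegner twist,
tree theorem `rootNumber_quadraticTwist_discr_eq_neg_of_exists_isNewformOf`).

* §34 `natCard_selmerGroup_dvd_mul_of_agree_of_forall_localization_eq_zero` — congruent pair over any number field: agreement off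
  `v₀`, the one-place Poitou–Tate count `[H¹_{𝓚^{v₀}} : H¹_{𝓚_{v₀}}] = t_{v₀} = p`, all Selmer classes of `E` strict at `v₀` ⟹
  `#Sel(Y) ∣ p · #Sel(E)` (so, with §27 of `…StrictInherit`, `#Sel(Y) ∈ {#Sel(E), p·#Sel(E)}`). NO transversality is used.
* §35 `natCard_selmerGroup_dvd_two_mul_twist_of_places_of_forall_localization_eq_zero` — twist pair at `p = 2`, place menu, `v₀ ∤ 2`,
  `#W(K_{v₀})[2] = 2`.
* §36 `natCard_selmerGroup_twin_dvd_two_mul_of_le_strictLocalKer` — `ℚ`-instance for the prime Heegner twin (currency of p624297).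
* §37 `natCard_selmerGroup_twin_eq_two_mul_of_le_strictLocalKer` — **COR. 3.4 (i) UP**: `W/ℚ` globally minimal, `Δ_W < 0`, `ρ̄_{W,2}`
  onto, `K` imaginary quadratic with `d_K = −ℓ` odd, Heegner for `N_W`, `2` split, `Wd` any model of `W^{(d_K)}`, `Sel₂(W)` strict at
  `ℓ` ⟹ `#Sel₂(Wd) = 2 · #Sel₂(W)`, modulo {PT, Tate χ, 2-parity, Cassels–Tate, modularity} — all route print items. Parity step:
  `#Sel₂ = 2^s`, no rational `2`-torsion on either curve (`ρ̄₂` onto), `s ≡ corank Sel_{2^∞} (mod 2)` (Cassels–Tate,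
  `exists_selmerRank_eq_add`), `(−1)^{corank} = w` (2-parity), `w(Wd) = −w(W)` (Heegner twist) ⟹ `s(Wd) ≠ s(W)`; with
  `2^{s(W)} ∣ 2^{s(Wd)} ∣ 2^{s(W)+1}` this forces `s(Wd) = s(W) + 1`.
With p624297 this makes gk2-p5 g6's dichotomy `GenusKolyTwin.cor34i_twin_prime_heegner` free of `MazurRubin2010.cor34i_singleton_rat`
in BOTH directions (modulo the displayed print items), and sharpens this seat's entangled capstones («even `#Sel₂`») to «`#Sel₂ = 4`».

References: [MazurRubin2010] Lemma 3.2, Prop. 3.3, Cor. 3.4 (i), Thm. 2.7 (parity: Kramer / MR07); [DokchitserDokchitserAnnals2010] Thm. 1.4;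
[Cassels1962ArithmeticIV]; [MilneADT2006] I Thm. 2.8, 4.10, 6.13; [GrossLMS1991] §1; [BCDTJAMS2001].
-/

set_option linter.dupNamespace false -- tree convention: `Summit.BirchSwinnertonDyer.BirchSwinnertonDyer.Theorems` (summit = sub-problem)
set_option autoImplicit false

noncomputable section

open scoped Classical ContRepresentation AddSubgroup

namespace Summit.BirchSwinnertonDyer.BirchSwinnertonDyer.Theorems.GenusKolyTwistLocal

open WeierstrassCurve Field NumberField IsDedekindDomain Function
open Literature.NumberTheory.EllipticCurves Literature.NumberTheory.GaloisRepresentations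
open Literature.NumberTheory.GaloisRepresentations.DiscreteGaloisModule (SelmerStructure)
open Literature.NumberTheory.GaloisCohomology
open Summit.BirchSwinnertonDyer.Rank1Residual.X11b.CongruentTransfer
open Summit.BirchSwinnertonDyer.Rank1Residual.X11b.SelmerCount (card_mul_relIndex_of_le)
open Summit.BirchSwinnertonDyer.Rank1Residual.X11b.KummerPT (kummerStrict kummerRelaxed kummerStrict_of_mem
  kummerStrict_of_not_mem)
open Rat.HeightOneSpectrum (primesEquiv natGenerator)
open Literature.NumberTheory.EllipticCurves.ModularForms (exists_isNewformOf)

/-! ## §34 Strict + the one-place Poitou–Tate count: `#Sel(Y) ∣ p · #Sel(E)` (congruent pair, any number field) -/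

section Strict

variable {K : Type} [Field K] [NumberField K] (W Y : WeierstrassCurve K) [W.IsElliptic] (p : ℕ) [hp : Fact p.Prime]

/-- **STRICT + Poitou–Tate count ⟹ `#Sel^{(p)}(Y) ∣ p · #Sel^{(p)}(E)`** for a congruent pair `Y[p] ≅ E[p]` over a number field `K`.
HYPOTHESES: the print facts `poitouTate_selmerStructure_duality_real K` and `localEulerPoincareCharacteristic K_v`; inverse intertwining
maps `φ, ψ`; the transported Kummer structure `𝓐 = φ_*𝓚_Y` (`h𝓐`); one finite place `v₀` off which `𝓐` agrees with `𝓚_E`;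
`t_{v₀}(E, p) = #E(K_{v₀})[p] · #(𝓞_{v₀}/p) = p`; and `loc_{v₀} c = 0` for every `c ∈ Sel^{(p)}(E)` (STRICT). Then `Sel(E) = H¹_{𝓚_{v₀}}`,
`H¹_𝓐 ≤ H¹_{𝓚^{v₀}}` and `[H¹_{𝓚^{v₀}} : H¹_{𝓚_{v₀}}] = p`, so `#Sel(Y) = #H¹_𝓐 ∣ p · #Sel(E)`. Together with the duality-free
`natCard_selmerGroup_dvd_of_agree_of_forall_localization_eq_zero` (`#Sel(E) ∣ #Sel(Y)`): `#Sel(Y) ∈ {#Sel(E), p·#Sel(E)}` — Mazur–Rubin's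
`d₂(E^F) = d₂(E) − dim V_T + d`, `0 ≤ d ≤ 1`, in the case `V_T = 0`; the parity `d ≡ 1` is NOT decided here. No transversality is used.
[cite: MazurRubin2010, Lemma 3.2, Prop. 3.3, Cor. 3.4 (i) (arXiv:0904.3709 p. 10)] [cite: MilneADT2006, Ch. I, Thm. 4.10] -/
theorem natCard_selmerGroup_dvd_mul_of_agree_of_forall_localization_eq_zero
    (hPT : poitouTate_selmerStructure_duality_real K)
    (hEP : ∀ v : HeightOneSpectrum (𝓞 K), localEulerPoincareCharacteristic (v.adicCompletion K))
    (φ : (Y.torsionGaloisModule (p : ℤ)).toContRepresentation →ⁱL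
      (W.torsionGaloisModule (p : ℤ)).toContRepresentation)
    (ψ : (W.torsionGaloisModule (p : ℤ)).toContRepresentation →ⁱL
      (Y.torsionGaloisModule (p : ℤ)).toContRepresentation)
    (hψφ : ∀ a, ψ (φ a) = a) (hφψ : ∀ b, φ (ψ b) = b)
    (𝓐 : SelmerStructure (W.torsionGaloisModule (p : ℤ)))
    (h𝓐 : ∀ v, 𝓐 v = (Y.kummerSelmerStructure (p : ℤ) v).map
      (galoisCohomology.map (φ.restrictField (Place.Completion v)) 1))
    (v₀ : HeightOneSpectrum (𝓞 K))
    (hagree : ∀ v : Place K, v ≠ Sum.inr v₀ → 𝓐 v = W.kummerSelmerStructure (p : ℤ) v)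
    (ht : Nat.card (nsmulAddMonoidHom p : (W.baseChange (v₀.adicCompletion K)).toAffine.Point →+ _).ker *
        Nat.card (v₀.adicCompletionIntegers K ⧸ Ideal.span {(p : v₀.adicCompletionIntegers K)}) = p)
    (hstrict : ∀ c ∈ (W.kummerSelmerStructure (p : ℤ)).selmerGroup,
      galoisCohomology.localization (W.torsionGaloisModule (p : ℤ)) (Sum.inr v₀) 1 c = 0) :
    Nat.card (Y.selmerGroup (p : ℤ)) ∣ p * Nat.card (W.selmerGroup (p : ℤ)) := by
  set S : Finset (Place K) := {(Sum.inr v₀ : Place K)} with hS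
  have hagreeS : ∀ v ∉ S, 𝓐 v = W.kummerSelmerStructure (p : ℤ) v := fun v hv ↦
    hagree v (by simpa [hS] using hv)
  obtain ⟨-, hAhi⟩ := selmerGroup_sandwich_of_agree W p S hagreeS
  obtain ⟨hKlo, hKhi⟩ := selmerGroup_sandwich_kummer W p S
  have hidx : (kummerStrict W p S).selmerGroup.relIndex (kummerRelaxed W p S).selmerGroup = p := by
    rw [hS, relIndex_kummerStrict_kummerRelaxed_singleton_eq_of_facts W p hPT hEP v₀, ht]
  -- `Sel(E)` IS the strict group
  have hKeq : (W.kummerSelmerStructure (p : ℤ)).selmerGroup = (kummerStrict W p S).selmerGroup := by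
    refine le_antisymm (fun c hc ↦ ?_) hKlo
    refine mem_selmerGroup_kummerStrict_of_forall_localization_eq_zero W p S hc fun v hv ↦ ?_
    have hv' : v = Sum.inr v₀ := by simpa [hS] using hv
    subst hv'
    exact hstrict c hc
  -- `#H¹_{𝓚^{v₀}} = #Sel(E) · p`
  have hcount := card_mul_relIndex_of_le (hKlo.trans hKhi)
  rw [hidx, ← hKeq] at hcount
  -- `#H¹_𝓐 ∣ #H¹_{𝓚^{v₀}}`
  have hdvd : Nat.card 𝓐.selmerGroup ∣ Nat.card (kummerRelaxed W p S).selmerGroup := AddSubgroup.card_dvd_of_le hAhi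
  rw [← hcount, natCard_selmerGroup_transport_kummer W Y p φ ψ hψφ hφψ 𝓐 h𝓐,
    ← selmerGroup_eq_selmerGroup_kummerSelmerStructure, mul_comm] at hdvd
  exact hdvd

end Strict

/-! ## §35 The twist pair at `p = 2`: strict at `v₀` ⟹ `#Sel₂(E^{(d)}) ∣ 2 · #Sel₂(E)`, from the place menu and `#W(K_{v₀})[2] = 2` -/

section Twist

variable {K : Type} [Field K] [NumberField K] (W : WeierstrassCurve K) [W.IsElliptic]

/-- **Strict case of Cor. 3.4 (i) for `(E, E^{(d)})` at `p = 2`, upper bound `#Sel₂(E^{(d)}) ∣ 2 · #Sel₂(E)`.** `W` elliptic over a number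
field `K`, `d ≠ 0`, ANY elliptic model `Wd` of `W^{(d)}`, a finite `v₀ ∤ 2` with `#W(K_{v₀})[2] = 2`, the place menu off `v₀` (split ∨ both
good `∤ 2` ∨ silent; split ∨ `H¹ = 0` at `∞` — verbatim as in the lead's `natCard_selmerGroup_twist_mul_two_eq_of_places`), and every class of
`Sel₂(W)` with zero localisation at `v₀`; granted `poitouTate_selmerStructure_duality_real K` and `localEulerPoincareCharacteristic K_v`. No
ramification or transversality hypothesis at `v₀`. [cite: MazurRubin2010, Lemma 2.10, Lemma 3.2, Prop. 3.3, Cor. 3.4 (i)]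
[cite: MilneADT2006, Ch. I, Thm. 2.8 and Thm. 4.10] -/
theorem natCard_selmerGroup_dvd_two_mul_twist_of_places_of_forall_localization_eq_zero
    (hPT : poitouTate_selmerStructure_duality_real K)
    (hEP : ∀ v : HeightOneSpectrum (𝓞 K), localEulerPoincareCharacteristic (v.adicCompletion K))
    {d : K} (hd : d ≠ 0) {Wd : WeierstrassCurve K} [Wd.IsElliptic] {C : VariableChange K}
    (hWd : C • W.quadraticTwist d = Wd) (v₀ : HeightOneSpectrum (𝓞 K)) (hv₀ : ((2 : ℕ) : 𝓞 K) ∉ v₀.asIdeal)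
    (hfin : ∀ v : HeightOneSpectrum (𝓞 K), v ≠ v₀ →
      (∃ s : v.adicCompletion K, s ^ 2 = algebraMap K (v.adicCompletion K) d) ∨
      (((2 : ℕ) : 𝓞 K) ∉ v.asIdeal ∧ W.HasGoodReductionAt v ∧ Wd.HasGoodReductionAt v) ∨
      (((2 : ℕ) : 𝓞 K) ∉ v.asIdeal ∧
        Nat.card (nsmulAddMonoidHom 2 : (W.baseChange (v.adicCompletion K)).toAffine.Point →+ _).ker = 1 ∧
        Nat.card (nsmulAddMonoidHom 2 : (Wd.baseChange (v.adicCompletion K)).toAffine.Point →+ _).ker = 1))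
    (hinf : ∀ w : InfinitePlace K,
      (∃ s : w.Completion, s ^ 2 = algebraMap K w.Completion d) ∨
      ((∀ x : galoisCohomology (W.localGaloisModule w.Completion) 1, x = 0) ∧
        (∀ x : galoisCohomology (Wd.localGaloisModule w.Completion) 1, x = 0)))
    (ht : Nat.card (nsmulAddMonoidHom 2 : (W.baseChange (v₀.adicCompletion K)).toAffine.Point →+ _).ker = 2)
    (hstrict : ∀ c ∈ (W.kummerSelmerStructure ((2 : ℕ) : ℤ)).selmerGroup,
      galoisCohomology.localization (W.torsionGaloisModule ((2 : ℕ) : ℤ)) (Sum.inr v₀) 1 c = 0) :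
    Nat.card (Wd.selmerGroup ((2 : ℕ) : ℤ)) ∣ 2 * Nat.card (W.selmerGroup ((2 : ℕ) : ℤ)) := by
  haveI : NeZero (2 : K) := ⟨two_ne_zero⟩
  haveI : Fact (Nat.Prime 2) := ⟨Nat.prime_two⟩
  obtain ⟨φ, ψ, hψφ, hφψ, hsplit⟩ := exists_intertwining_hsplit W hd hWd
  let 𝓐 : SelmerStructure (W.torsionGaloisModule ((2 : ℕ) : ℤ)) := fun v ↦
    (Wd.kummerSelmerStructure ((2 : ℕ) : ℤ) v).map
      (galoisCohomology.map (φ.restrictField (Place.Completion v)) 1)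
  have h𝓐 : ∀ v, 𝓐 v = (Wd.kummerSelmerStructure ((2 : ℕ) : ℤ) v).map
      (galoisCohomology.map (φ.restrictField (Place.Completion v)) 1) := fun _ ↦ rfl
  refine natCard_selmerGroup_dvd_mul_of_agree_of_forall_localization_eq_zero W Wd 2 hPT hEP φ ψ hψφ hφψ 𝓐 h𝓐 v₀ ?_
    ?_ hstrict
  · -- agreement at every place other than `v₀` (verbatim from `natCard_selmerGroup_twist_mul_two_eq_of_local`)
    rintro (w | v) hv
    · rcases hinf w with ⟨s, hs⟩ | ⟨hW, hWd'⟩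
      · rw [h𝓐, kummerSelmerStructure_apply, kummerSelmerStructure_apply]
        exact hsplit (Place.Completion (Sum.inl w)) ⟨s, hs⟩
      · rw [h𝓐, kummerSelmerStructure_apply, kummerSelmerStructure_apply]
        exact map_kummerLocalConditionAt_eq_of_eq_top W Wd ((2 : ℕ) : ℤ) (Place.Completion (Sum.inl w)) φ ψ hφψ
          (kummerLocalConditionAt_eq_top_of_forall_eq_zero Wd _ _ hWd')
          (kummerLocalConditionAt_eq_top_of_forall_eq_zero W _ _ hW)
    · have hvv₀ : v ≠ v₀ := fun h ↦ hv (by rw [h])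
      rcases hfin v hvv₀ with ⟨s, hs⟩ | ⟨h2v, hvW, hvWd⟩ | ⟨h2v, h1W, h1Wd⟩
      · rw [h𝓐, kummerSelmerStructure_apply, kummerSelmerStructure_apply]
        exact hsplit (Place.Completion (Sum.inr v)) ⟨s, hs⟩
      · exact transport_kummer_inr_eq_of_good W Wd 2 φ ψ hφψ 𝓐 h𝓐 h2v hvW hvWd
      · rw [h𝓐, kummerSelmerStructure_apply, kummerSelmerStructure_apply]
        exact map_kummerLocalConditionAt_adicCompletion_eq_of_natCard_ker_eq_one W Wd v two_ne_zero h2v h1W h1Wd φ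
  · -- `t_{v₀} = 2`
    rw [ht, natCard_quotient_span_natCast_eq_one_of_not_mem v₀ hv₀, mul_one]

end Twist

/-! ## §36 The `ℚ`-instance for the prime Heegner twin: strict ⟹ `#Sel₂(Wd) ∣ 2 · #Sel₂(W)` -/

section Rat

variable (W : WeierstrassCurve ℚ)

/-- **Strict case, upper bound, for the prime Heegner twin over `ℚ`** (companion of p624297 / p625846): `W/ℚ` globally minimal elliptic,
`Δ_W < 0`, `K` imaginary quadratic with `d_K = −ℓ` odd, Heegner for `N_W`, `2` split, `Wd` an elliptic model of `W^{(d_K)}`,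
`Sel₂(W) ≤ MazurRubin2010.strictLocalKer W ℚ_ℓ 2` ⟹ `#Sel₂(Wd) ∣ 2 · #Sel₂(W)`, granted `hPT`, `hEP`. (`#W(ℚ_ℓ)[2] = 2`:
`GenusKolyTwin.natCard_twoTorsion_padic_eq_two_of_discr_eq_neg_prime`; place menu: `twist_place_menu_finite_rat` / `…_infinite_rat`.)
[cite: MazurRubin2010, Prop. 3.3, Cor. 3.4 (i)] [cite: MilneADT2006, I Thm. 2.8, I Thm. 4.10] [cite: GrossLMS1991, §1 (p. 235)] -/
theorem natCard_selmerGroup_twin_dvd_two_mul_of_le_strictLocalKer [W.IsElliptic] [W.IsGloballyMinimal]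
    {K : Type} [Field K] [NumberField K]
    (hPT : poitouTate_selmerStructure_duality_real ℚ)
    (hEP : ∀ v : HeightOneSpectrum (𝓞 ℚ), localEulerPoincareCharacteristic (v.adicCompletion ℚ))
    (hΔ : W.Δ < 0) (hK : IsImaginaryQuadratic K) (hodd : Odd (discr K))
    (hH : SatisfiesHeegnerHypothesis (W.conductorNorm ℤ) K) (h2K : ((Ideal.span {(2 : ℤ)}).primesOver (𝓞 K)).ncard = 2)
    {ℓ : ℕ} [Fact ℓ.Prime] (hd : discr K = -(ℓ : ℤ)) (Wd : WeierstrassCurve ℚ) [Wd.IsElliptic]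
    (hWd : ∃ C : VariableChange ℚ, C • W.quadraticTwist (discr K : ℚ) = Wd)
    (hs : W.selmerGroup 2 ≤ MazurRubin2010.strictLocalKer W ℚ_[ℓ] 2) :
    Nat.card (Wd.selmerGroup 2) ∣ 2 * Nat.card (W.selmerGroup 2) := by
  have hℓ : ℓ.Prime := Fact.out
  obtain ⟨hℓ2, hℓN, -⟩ := GenusKolyTwin.prime_discr_facts W hK hodd hH hℓ hd
  -- the place `v₀` of `ℚ` over `ℓ`
  obtain ⟨v₀, hv₀⟩ : ∃ v : HeightOneSpectrum (𝓞 ℚ), ((primesEquiv v : Nat.Primes) : ℕ) = ℓ :=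
    ⟨primesEquiv.symm ⟨ℓ, hℓ⟩, by rw [Equiv.apply_symm_apply]⟩
  have hℓv₀ : (ℓ : 𝓞 ℚ) ∈ v₀.asIdeal := by
    rw [← hv₀]
    exact Rat.HeightOneSpectrum.natCast_natGenerator_mem v₀
  obtain ⟨C, hC⟩ := hWd
  have hd0 : (discr K : ℚ) ≠ 0 := by
    rw [hd]
    push_cast
    exact neg_ne_zero.mpr (by exact_mod_cast hℓ.ne_zero)
  have h2v₀ : ((2 : ℕ) : 𝓞 ℚ) ∉ v₀.asIdeal :=
    GenusKolyTwistingPrime.natCast_not_mem_of_not_dvd hℓ hℓv₀ fun h ↦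
      hℓ2 ((Nat.prime_dvd_prime_iff_eq hℓ Nat.prime_two).mp h)
  -- `#W(ℚ_{v₀})[2] = 2`
  have ht : Nat.card (nsmulAddMonoidHom 2 :
      (W.baseChange (v₀.adicCompletion ℚ)).toAffine.Point →+ _).ker = 2 := by
    rw [natCard_ker_nsmul_adicCompletion_eq_padic W v₀ 2]
    subst hv₀
    exact GenusKolyTwin.natCard_twoTorsion_padic_eq_two_of_discr_eq_neg_prime W hK hodd hH hd hΔ
  -- strictness in the localisation currency
  have hstrict : ∀ c ∈ (W.kummerSelmerStructure ((2 : ℕ) : ℤ)).selmerGroup,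
      galoisCohomology.localization (W.torsionGaloisModule ((2 : ℕ) : ℤ)) (Sum.inr v₀) 1 c = 0 := by
    apply forall_selmer_localization_eq_zero_of_le_strictLocalKer W v₀
    subst hv₀
    exact hs
  have h := natCard_selmerGroup_dvd_two_mul_twist_of_places_of_forall_localization_eq_zero W hPT hEP hd0 hC v₀ h2v₀
    (twist_place_menu_finite_rat W hK.1 hH h2K hℓ hd hℓv₀ hC) (twist_place_menu_infinite_rat W hΔ hd0 hC) ht hstrict
  exact h

/-! ## §37 COR. 3.4 (i) UP for the prime Heegner twin, modulo {PT, Tate χ, 2-parity, Cassels–Tate, modularity} -/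

/-- `ρ̄_{W,2}` onto ⟹ `W(ℚ)[2] = 0`. [cite: SilvermanAEC2009, III.1, Cor. III.6.4(b)] -/
theorem torsionBy_two_eq_bot_of_hasSurjectiveModNGaloisRep_rat [W.IsElliptic] (hsurj : W.HasSurjectiveModNGaloisRep 2) :
    W.toAffine.Point[(2 : ℤ)] = ⊥ := by
  haveI : Fact (Nat.Prime 2) := ⟨Nat.prime_two⟩
  have hirr : Rank1Residual.Irr W 2 := Summit.BirchSwinnertonDyer.Rank1Residual.irr_of_surj (W := W) (p := 2) hsurj
  exact Summit.BirchSwinnertonDyer.Uniform.U2.torsionBy_two_eq_bot_iff.mpr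
    ((Summit.BirchSwinnertonDyer.Rank1Residual.X5.O1.irr_two_iff_forall_two_nsmul W).mp hirr)

/-- **The parity of the `2`-Selmer exponent is that of the root number** when `E(ℚ)[2] = 0`: `#Sel₂(V) = 2^s`, `V(ℚ)[2] = 0`,
the 2-parity theorem `p_parity V 2` and the Cassels–Tate pairing ⟹ `(−1)^s = w(V)` (`s = corank Sel_{2^∞} + 2m`, `exists_selmerRank_eq_add`).
[cite: DokchitserDokchitserAnnals2010, Thm. 1.4] [cite: Cassels1962ArithmeticIV] -/
theorem neg_one_pow_eq_rootNumber_of_torsionBy_two_eq_bot (V : WeierstrassCurve ℚ) [V.IsElliptic]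
    (hpar : p_parity V 2) (hCT : WeierstrassCurve.exists_casselsTate_pairing (K := ℚ))
    (hbot : V.toAffine.Point[(2 : ℤ)] = ⊥) {s : ℕ} (hs : Nat.card (V.selmerGroup 2) = 2 ^ s) :
    (-1 : ℤ) ^ s = V.rootNumber := by
  haveI : Fact (Nat.Prime 2) := ⟨Nat.prime_two⟩
  have h1 : Nat.card (V.toAffine.Point[(2 : ℤ)]) = 1 := by rw [hbot, AddSubgroup.card_bot]
  have h1' : Nat.card (V.toAffine.Point[((2 : ℕ) : ℤ)]) = 1 := by simpa using h1
  -- (`E(ℚ)[2]` elaborates against `instDecidableEqRat`, the number-field lemma against the classical instance: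
  -- `convert` bridges the subsingleton `DecidableEq` argument — tree idiom of `X10/RankOneOfPSelmerOrderP`)
  obtain ⟨m, hm⟩ := exists_selmerRank_eq_add hCT V 2 s 0 hs (by rw [pow_zero]; convert h1')
  have hpp : (-1 : ℤ) ^ V.selmerCorank 2 = V.rootNumber := hpar
  rw [← hpp, hm, zero_add, pow_add, pow_mul, neg_one_sq, one_pow, mul_one]

/-- **MAZUR–RUBIN COR. 3.4 (i), UP DIRECTION, FOR THE PRIME HEEGNER TWIN — KERNEL THEOREM modulo Poitou–Tate duality, Tate's local
Euler characteristic, the 2-parity theorem, the Cassels–Tate pairing and modularity** (the UP half of the print named fact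
`MazurRubin2010.cor34i_singleton_rat` as consumed by `GenusKolyTwin.cor34i_twin_prime_heegner`, same currency; the DOWN half is gk2-p5's
`natCard_selmerGroup_eq_two_mul_of_not_le_strictLocalKer`, p624297). Let `W/ℚ` be globally minimal elliptic with `Δ_W < 0` and `ρ̄_{W,2}` onto,
`K` imaginary quadratic with `d_K = −ℓ` odd (`ℓ` prime), Heegner for `N_W`, `2` split in `K`, `Wd` an elliptic model of `W^{(d_K)}`. IF `Sel₂(W)`
IS strict at `ℓ` (`Sel₂(W) ≤ MazurRubin2010.strictLocalKer W ℚ_ℓ 2`), THEN **`#Sel₂(Wd) = 2 · #Sel₂(W)`**. Proof: `#Sel₂(W) = 2^s ∣ #Sel₂(Wd) =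
2^{s'} ∣ 2^{s+1}` (p625846 §29, §36), and `s' ≢ s (mod 2)`: no rational `2`-torsion on `W` (`ρ̄₂` onto) nor on `Wd`
(`Uniform.U2.torsionBy_two_eq_bot_of_twist`), so `(−1)^s = w(W)`, `(−1)^{s'} = w(Wd)` (2-parity + Cassels–Tate), and
`w(Wd) = w(W^{(d_K)}) = −w(W)` (`rootNumber_smul_holds`, `rootNumber_quadraticTwist_discr_eq_neg_of_exists_isNewformOf` under the Heegner
hypothesis). CONDITIONAL on the displayed hypotheses `hPT`, `hEP` (Milne I 4.10 / 2.8), `hpar` (= route item `TwoParityDD`), `hCT` (= route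
item `CasselsTatePairingRat`), `hmod` (= route item `ModularityExistsNewform`) ONLY. BSD is not proved by this.
[cite: MazurRubin2010, Prop. 3.3, Cor. 3.4 (i), Thm. 2.7] [cite: DokchitserDokchitserAnnals2010, Thm. 1.4] [cite: MilneADT2006, I Thm. 4.10, I Thm. 6.13]
[cite: GrossLMS1991, §1 (p. 235)] -/
theorem natCard_selmerGroup_twin_eq_two_mul_of_le_strictLocalKer [W.IsElliptic] [W.IsGloballyMinimal]
    {K : Type} [Field K] [NumberField K]
    (hPT : poitouTate_selmerStructure_duality_real ℚ)
    (hEP : ∀ v : HeightOneSpectrum (𝓞 ℚ), localEulerPoincareCharacteristic (v.adicCompletion ℚ))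
    (hpar : ∀ V : WeierstrassCurve ℚ, p_parity V 2)
    (hCT : WeierstrassCurve.exists_casselsTate_pairing (K := ℚ)) (hmod : exists_isNewformOf)
    (hΔ : W.Δ < 0) (hsurj : W.HasSurjectiveModNGaloisRep 2) (hK : IsImaginaryQuadratic K) (hodd : Odd (discr K))
    (hH : SatisfiesHeegnerHypothesis (W.conductorNorm ℤ) K) (h2K : ((Ideal.span {(2 : ℤ)}).primesOver (𝓞 K)).ncard = 2)
    {ℓ : ℕ} [Fact ℓ.Prime] (hd : discr K = -(ℓ : ℤ)) (Wd : WeierstrassCurve ℚ) [Wd.IsElliptic]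
    (hWd : ∃ C : VariableChange ℚ, C • W.quadraticTwist (discr K : ℚ) = Wd)
    (hs : W.selmerGroup 2 ≤ MazurRubin2010.strictLocalKer W ℚ_[ℓ] 2) :
    Nat.card (Wd.selmerGroup 2) = 2 * Nat.card (W.selmerGroup 2) := by
  haveI : Fact (Nat.Prime 2) := ⟨Nat.prime_two⟩
  have hd0 : (discr K : ℚ) ≠ 0 := by exact_mod_cast NumberField.discr_ne_zero K
  -- the two divisibilities
  have hlo : Nat.card (W.selmerGroup 2) ∣ Nat.card (Wd.selmerGroup 2) :=
    natCard_selmerGroup_dvd_twin_of_le_strictLocalKer W hΔ hK hH h2K hd Wd hWd hs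
  have hhi : Nat.card (Wd.selmerGroup 2) ∣ 2 * Nat.card (W.selmerGroup 2) :=
    natCard_selmerGroup_twin_dvd_two_mul_of_le_strictLocalKer W hPT hEP hΔ hK hodd hH h2K hd Wd hWd hs
  -- exponents
  obtain ⟨s, hsW⟩ := exists_natCard_selmerGroup_eq_pow W 2
  obtain ⟨s', hsWd⟩ := exists_natCard_selmerGroup_eq_pow Wd 2
  have hsW' : Nat.card (W.selmerGroup 2) = 2 ^ s := hsW
  have hsWd' : Nat.card (Wd.selmerGroup 2) = 2 ^ s' := hsWd
  rw [hsW', hsWd'] at hlo hhi ⊢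
  rw [← pow_succ'] at hhi
  have h1 : s ≤ s' := (Nat.pow_dvd_pow_iff_le_right one_lt_two).mp hlo
  have h2 : s' ≤ s + 1 := (Nat.pow_dvd_pow_iff_le_right one_lt_two).mp hhi
  -- parity: `(−1)^s = w(W)`, `(−1)^{s'} = w(Wd) = −w(W)`
  obtain ⟨C, hC⟩ := hWd
  have hbotW : W.toAffine.Point[(2 : ℤ)] = ⊥ := torsionBy_two_eq_bot_of_hasSurjectiveModNGaloisRep_rat W hsurj
  have hbotWd : Wd.toAffine.Point[(2 : ℤ)] = ⊥ :=
    Summit.BirchSwinnertonDyer.Uniform.U2.torsionBy_two_eq_bot_of_twist W hd0 Wd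
      ⟨C⁻¹, by rw [← hC, smul_smul, inv_mul_cancel, one_smul]⟩ hbotW
  have hwW : (-1 : ℤ) ^ s = W.rootNumber := neg_one_pow_eq_rootNumber_of_torsionBy_two_eq_bot W (hpar W) hCT hbotW hsW'
  have hwWd : (-1 : ℤ) ^ s' = Wd.rootNumber :=
    neg_one_pow_eq_rootNumber_of_torsionBy_two_eq_bot Wd (hpar Wd) hCT hbotWd hsWd'
  have htw : Wd.rootNumber = -W.rootNumber := by
    haveI := W.isElliptic_quadraticTwist hd0
    rw [← rootNumber_quadraticTwist_discr_eq_neg_of_exists_isNewformOf W K hmod hK hH, ← hC]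
    exact rootNumber_smul_holds (W.quadraticTwist (discr K : ℚ)) C
  have hne : s' ≠ s := by
    intro heq
    rw [heq, hwW] at hwWd
    rw [← hwWd] at htw
    have h0 : W.rootNumber = 0 := by linarith
    rw [← hwW] at h0
    exact (pow_ne_zero s (by norm_num : (-1 : ℤ) ≠ 0)) h0
  have hs' : s' = s + 1 := by omega
  rw [hs', pow_succ']

end Rat

end Summit.BirchSwinnertonDyer.BirchSwinnertonDyer.Theorems.GenusKolyTwistLocal

end
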